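/-
Copyright (c) 2026 the pub-hodgecm-mathlib formalisation cell (harness21).  Prover seat hodgecm-mathlib-K2Liu-p26 (g2): Track B «K2-LIT»,
#184♮ = hLiu418 = stmt-HodgeConjecture-24832; #42F′ FACE-G, organ F4 (G-gen), road (E) «compact see-saw + FFT + PBW + `K_H`-averaging» (RULING M-158r∕M-158u,
F4 lead K2Liu-p27 (g2): ROAD VERDICT 23:03:11Z «(E-d) → K2Liu-p26», interface memo `MEMO-F4-E-Interface` §1(E-d), ★ p862931 (E-f) core), brick (E-d-R): THE
REDUCTION — from a `K_H`-invariant section functional to a `K_H`-invariant representative, finite-dimensionally, and ★ (E-f)'s letter (RED) modulo the pivot.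
-/
import Summits.HodgeConjecture.HodgeConjecture.Theorems.K2LiuLocalThetaKHAveraging       -- ★ (E-d) §1 p862900: `apply_integral_orbit_eq`, `map_integral_orbit_eq`, `haarAverage_package`
import Summits.HodgeConjecture.HodgeConjecture.Theorems.K2LiuWeilDatumFockStabilityU22   -- ★ `κOp_binvPi` (imports ★ `κOp`, `vacScalar`, `dualPairι`, `binvPi`, `linSubst`)
import Literature.RepresentationTheory.KonnoKonno2007.JunctionHyperbolicFockMatrix       -- ★ `linSubst_linSubst`
import Literature.RepresentationTheory.KonnoKonno2007.JunctionContinuityKAK              -- ★ `compactSpace_matrixUnitaryGroup`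
import Literature.Analysis.SegalBargmann.FockInfinitesimalAction                         -- ★ `totalDegree_linSubst_le`, `degLE`, `support_subset_degLE`, `linForm`
import HarnessLib

/-!
# Crux `HLiu418`, organ F4 (G-gen), road (E), brick (E-d-R): THE FINITE-DIMENSIONAL REDUCTION «invariant functional ⇒ invariant representative»,
# its polynomial instance, and ★ (E-f)'s letter (RED) modulo the see-saw pivot (`Theorems/K2LiuLocalThetaReduction.lean`)

Cell `hodgecm-mathlib`, crux item hLiu418 = `stmt-HodgeConjecture-24832`, route of record `HCCMUnconditional`; squad K2 ∕ K2Liu, road `K2_Liu`, socket #42F′,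
FACE-G ∕ organ F4 (G-gen); F4 lead K2Liu-p27 (g2); desks K2Liu-p10 (g6), K2E5-r02 (g6).  THEOREMS ONLY (no `def`, no `instance`, no `notation`, no named-fact
hypothesis, no `sorry`); lane `--supports stmt-HodgeConjecture-24832` (count-neutral helper).

WHAT ★ (E-f) `K2LiuLocalThetaCyclicUniform` CONSUMES FROM (E-d) (letter (RED), by value): `∀ F : A, ∃ F₀ : A, (∀ g, subst g F₀ = F₀) ∧ SW (B F) = SW (B F₀)` — every
Fock polynomial `F` has a `K_H`-INVARIANT polynomial `F₀` with THE SAME SECTION.  The mathematics (K2E5-r02 (g6) road (E) STEP 3; memo §1(E-d)): average `F` over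
the compact group `K_H` (Reynolds) — this needs no Bochner integral on the Schwartz space, because `F` lives in the FINITE-DIMENSIONAL `K_H`-stable space of
polynomials of degree `≤ deg F`, and the section functional `Λ := SW ∘ B` is `K_H`-INVARIANT there (the see-saw PIVOT), hence blind to the averaging.
ONE HONEST SUBTLETY (census 23:21:12Z): the framed compact operators act on `B F = binvPi F` by `κOp R S e k (binvPi F) = binvPi (vacScalar e k • linSubst (…k…) F)`
(★ `κOp_binvPi`) with the vacuum character `vacScalar e (1,(c,d)) = det c⁻² det d⁻² ≠ 1` on `K_H`; road (E) therefore takes `subst k :=` the UNTWISTED substitution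
`linSubst (star ↑(dualPairι (1,k)))` (so that (FFT) is the honest first fundamental theorem), and the character appears only inside the pivot, where it cancels.
THIS FILE:
* §2 **`exists_invariant_of_invariant_functional`** — GENERIC: a compact group `K` acting ℂ-linearly (`ρ : K →* Module.End ℂ A`) on a module `A`, a
  finite-dimensional `ρ`-stable subspace `U ∋ F` on which the action is continuous in coordinates, and a linear `Λ : A →ₗ[ℂ] W` with `Λ ∘ ρ k = Λ` ⇒
  `∃ F₀ ∈ U, (∀ k, ρ k F₀ = F₀) ∧ Λ F = Λ F₀` (coordinates `Module.finBasis` ⇒ the Banach space `Fin n → ℂ`, ★ (E-d) §1 `haarAverage_package` with `haarMeasure ⊤`,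
  and `Module.forall_dual_apply_eq_zero_iff` to test `Λ F = Λ F₀` through `ℂ`-valued functionals — `W` carries NO topology).
* §3 **`exists_linSubst_invariant_of_invariant_functional`** — THE POLYNOMIAL INSTANCE: `A := MvPolynomial σ ℂ`, `ρ k := linSubst (star ↑(j k))` for a continuous
  `j : K →* U(σ)` (★ `linSubst_linSubst` makes it a homomorphism), `U := restrictTotalDegree σ ℂ (deg F)` (Mathlib's `Module.Finite` instance; ★ `totalDegree_linSubst_le`);
  coordinate continuity **`continuous_coeff_linSubst`** (every coefficient of `linSubst M G` is continuous — indeed polynomial — in `M`; `induction_on` + `coeff_mul`).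
* §4 **`hRED_of_pivot`** — ★ (E-f)'s (RED) VERBATIM at the one-place objects (`A := MvPolynomial (DPIdx (Fin 2) (Fin 2) R S) ℂ`, `B := binvPi`, `G := U(R) × U(S)`,
  `subst k := linSubst (star ↑(dualPairι (1,k)))`), for ANY linear `SW : 𝓢σ →ₗ[ℂ] W`, MODULO ONE LETTER BY VALUE — the see-saw pivot
  `hpiv : ∀ k v, SW (κOp R S e (1,k) v) = vacScalar e (1,k) • SW v` (brick (E-d-P)); first **`sw_binvPi_linSubst_eq_of_pivot`**: the pivot makes `SW ∘ binvPi`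
  invariant under the untwisted substitution (★ `unitaryOpPi_binvPi`, ★ `κOp` = `vacScalar • unitaryOpPi ∘ dualPairι`, ★ `vacScalar_ne_zero`).
References: [Weyl1939] Ch. VIII §11 (averaging over the compact form); [BrockerTomDieck1985] II (1.7), III (the Reynolds operator on a finite-dimensional
representation); [Howe1989] §3 (see-saw ∕ `K`-invariants of the oscillator representation); [KudlaRallis1994] §3; [Folland1989] Prop. (4.39).
HONEST LABEL.  Count-neutral helper; it retires nothing by itself: `HC_CM` is proved only modulo the 7 printed citations (2 remaining named inputs:
hLiu418 = `stmt-HodgeConjecture-24832`, h413 = `stmt-HodgeConjecture-24833`) until rung 0 closes.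

## Tree search
★ (E-d) §1 `K2LiuLocalThetaKHAveraging` (Bochner orbit average on a Banach space); ★ `SegalBargmann.FockUnitaryAction.linSubst` (+ `linSubst_X_eq_linForm`, `coeff_linForm`,
`totalDegree_linSubst_le`, `support_subset_degLE`, `linSubst_one_apply`), ★ `KonnoKonno2007.linSubst_linSubst`, ★ `unitaryOpPi_binvPi`, ★ `κOp`, `vacScalar_ne_zero`,
`dualPairι`, `continuous_dualPairι`, `compactSpace_matrixUnitaryGroup`; Mathlib `Module.finBasis`, `Basis.equivFun`, `LinearMap.toContinuousLinearMap`,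
`LinearMap.exists_extend`, `Module.forall_dual_apply_eq_zero_iff`, `MvPolynomial.restrictTotalDegree` (+ its `Module.Finite` instance), `MvPolynomial.coeff_mul`.
Dedup `rg "exists_invariant_of_invariant_functional|continuous_coeff_linSubst|hRED_of_pivot"` over `lean/` = ∅.
-/

set_option autoImplicit false
set_option linter.dupNamespace false -- the mandated namespace repeats `HodgeConjecture.HodgeConjecture`

noncomputable section

open MeasureTheory MvPolynomial
open Literature.RepresentationTheory.CompactGroups
open Literature.Analysis.SegalBargmann
open Literature.RepresentationTheory.KonnoKonno2007 Literature.RepresentationTheory.KonnoKonno2007.RealDualPair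
open Summit.HodgeConjecture.HodgeConjecture.Cruxes.HLiu418.K2LiuLocalThetaKHAveraging
open Summit.HodgeConjecture.HodgeConjecture.Cruxes.HLiu418.K2LiuWeilDatumSmoothU22

namespace Summit.HodgeConjecture.HodgeConjecture.Cruxes.HLiu418.K2LiuLocalThetaReduction

/-! ## §2 Generic: an invariant functional admits an invariant representative on a finite-dimensional stable subspace -/

/-- **REYNOLDS REDUCTION «invariant functional ⇒ invariant representative»** (finite-dimensional, no topology on the target): a compact group `K` acting
ℂ-linearly on a module `A` (`ρ : K →* Module.End ℂ A`), a finite-dimensional `ρ`-stable subspace `U ∋ F` on which `k ↦ ρ k G` is continuous in coordinates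
(tested through linear functionals `ℓ : A →ₗ ℂ`), and a linear map `Λ : A →ₗ[ℂ] W` INVARIANT under the action (`Λ (ρ k G) = Λ G`): then some `F₀ ∈ U` is
`ρ`-INVARIANT and has THE SAME VALUE `Λ F = Λ F₀` — namely the Haar average `F₀ = ∫_K ρ k F dk`, computed in coordinates of `U` (★ (E-d) §1 `haarAverage_package` on the
Banach space `Fin n → ℂ`), the equality `Λ F = Λ F₀` being tested through every `θ : W →ₗ ℂ` (`Module.forall_dual_apply_eq_zero_iff`).
[cite: BrockerTomDieck1985, II (1.7)] [cite: Weyl1939, Ch. VIII §11] -/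
theorem exists_invariant_of_invariant_functional {K : Type*} [Group K] [TopologicalSpace K] [IsTopologicalGroup K] [CompactSpace K]
    {A : Type*} [AddCommGroup A] [Module ℂ A] {W : Type*} [AddCommGroup W] [Module ℂ W]
    (ρ : K →* Module.End ℂ A) (U : Submodule ℂ A) [FiniteDimensional ℂ U] (hU : ∀ k : K, ∀ G ∈ U, ρ k G ∈ U)
    (hcont : ∀ G ∈ U, ∀ ℓ : A →ₗ[ℂ] ℂ, Continuous fun k : K => ℓ (ρ k G))
    (Λ : A →ₗ[ℂ] W) (hΛ : ∀ (k : K) (G : A), Λ (ρ k G) = Λ G) (F : A) (hF : F ∈ U) :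
    ∃ F₀ ∈ U, (∀ k : K, ρ k F₀ = F₀) ∧ Λ F = Λ F₀ := by
  classical
  borelize K
  -- coordinates on `U`
  set n : ℕ := Module.finrank ℂ U with hn_def
  let b : Module.Basis (Fin n) ℂ U := Module.finBasis ℂ U
  let e : U ≃ₗ[ℂ] (Fin n → ℂ) := b.equivFun
  -- the restricted action, transported to `Fin n → ℂ`
  let ρU : K → (U →ₗ[ℂ] U) := fun k => (ρ k).restrict (hU k)
  have hρU : ∀ (k : K) (x : U), ((ρU k x : U) : A) = ρ k x := fun k x => rfl
  let T : K → ((Fin n → ℂ) →ₗ[ℂ] (Fin n → ℂ)) := fun k => e.toLinearMap ∘ₗ ρU k ∘ₗ e.symm.toLinearMap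
  have hT : ∀ (k : K) (w : Fin n → ℂ), T k w = e (ρU k (e.symm w)) := fun k w => rfl
  have hρU_one : ∀ x : U, ρU 1 x = x := fun x => by
    apply Subtype.ext
    rw [hρU, map_one, Module.End.one_apply]
  have hρU_mul : ∀ (k k' : K) (x : U), ρU (k * k') x = ρU k (ρU k' x) := fun k k' x => by
    apply Subtype.ext
    rw [hρU, hρU, hρU, map_mul, Module.End.mul_apply]
  let π : K →* ((Fin n → ℂ) →L[ℂ] (Fin n → ℂ)) :=
    { toFun := fun k => LinearMap.toContinuousLinearMap (T k)
      map_one' := by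
        refine ContinuousLinearMap.ext fun w => ?_
        show LinearMap.toContinuousLinearMap (T 1) w = w
        rw [LinearMap.coe_toContinuousLinearMap', hT, hρU_one, LinearEquiv.apply_symm_apply]
      map_mul' := fun k k' => by
        refine ContinuousLinearMap.ext fun w => ?_
        show LinearMap.toContinuousLinearMap (T (k * k')) w = LinearMap.toContinuousLinearMap (T k) (LinearMap.toContinuousLinearMap (T k') w)
        rw [LinearMap.coe_toContinuousLinearMap', LinearMap.coe_toContinuousLinearMap', LinearMap.coe_toContinuousLinearMap', hT, hT, hT, hρU_mul,
          LinearEquiv.symm_apply_apply] }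
  have hπ : ∀ (k : K) (w : Fin n → ℂ), π k w = e (ρU k (e.symm w)) := fun k w => by
    show LinearMap.toContinuousLinearMap (T k) w = _
    rw [LinearMap.coe_toContinuousLinearMap', hT]
  -- orbit maps are continuous (coordinate by coordinate, through an extension of the coordinate functional to `A`)
  have hπc : ∀ w : Fin n → ℂ, Continuous fun k : K => π k w := by
    intro w
    refine continuous_pi fun i => ?_
    obtain ⟨ℓ, hℓ⟩ := LinearMap.exists_extend ((LinearMap.proj i : (Fin n → ℂ) →ₗ[ℂ] ℂ) ∘ₗ e.toLinearMap)
    have hℓ' : ∀ x : U, ℓ (x : A) = e x i := fun x => by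
      have h := LinearMap.congr_fun hℓ x
      rw [LinearMap.comp_apply, Submodule.subtype_apply, LinearMap.comp_apply] at h
      rw [h]
      rfl
    have hfun : (fun k : K => π k w i) = fun k : K => ℓ (ρ k ((e.symm w : U) : A)) := by
      funext k
      rw [hπ, ← hℓ', hρU]
    rw [hfun]
    exact hcont _ (e.symm w).2 ℓ
  -- the average
  obtain ⟨hinv, -, hmap⟩ := haarAverage_package π hπc (e ⟨F, hF⟩)
  set w₀ : Fin n → ℂ := ∫ k, π k (e ⟨F, hF⟩) ∂Measure.haarMeasure (⊤ : TopologicalSpace.PositiveCompacts K) with hw₀_def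
  refine ⟨((e.symm w₀ : U) : A), (e.symm w₀).2, fun h => ?_, ?_⟩
  · -- invariance: `ρ h F₀ = F₀`
    have h1 : ρU h (e.symm w₀) = e.symm w₀ := by
      apply e.injective
      rw [← hπ, hinv h, LinearEquiv.apply_symm_apply]
    rw [← hρU, h1]
  · -- same value, tested through every `θ : W →ₗ ℂ`
    rw [← sub_eq_zero, ← map_sub]
    refine (Module.forall_dual_apply_eq_zero_iff ℂ _).mp fun θ => ?_
    let f : (Fin n → ℂ) →L[ℂ] ℂ := LinearMap.toContinuousLinearMap ((θ ∘ₗ Λ ∘ₗ U.subtype) ∘ₗ e.symm.toLinearMap)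
    have hf_apply : ∀ w : Fin n → ℂ, f w = θ (Λ ((e.symm w : U) : A)) := fun w => by
      show LinearMap.toContinuousLinearMap ((θ ∘ₗ Λ ∘ₗ U.subtype) ∘ₗ e.symm.toLinearMap) w = _
      rw [LinearMap.coe_toContinuousLinearMap']
      rfl
    have hf : ∀ (k : K) (w' : Fin n → ℂ), f (π k w') = f w' := fun k w' => by
      rw [hf_apply, hf_apply, hπ, LinearEquiv.symm_apply_apply, hρU, hΛ]
    have h := hmap f hf
    rw [hf_apply, hf_apply, LinearEquiv.symm_apply_apply] at h
    rw [map_sub, map_sub, sub_eq_zero, ← h]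

/-! ## §3 The polynomial instance: linear substitutions by a compact group of unitary matrices -/

section Polynomial

variable {σ : Type*} [Fintype σ] [DecidableEq σ]

/-- **every coefficient of `linSubst M G` is continuous in the matrix `M`** (indeed polynomial: induction on `G`, the Cauchy product `coeff_mul`, and
`coeff (linSubst M (X n)) = Σ_k M_{nk} · coeff (X k)`). [folklore] -/
theorem continuous_coeff_linSubst (G : MvPolynomial σ ℂ) (m : σ →₀ ℕ) : Continuous fun M : Matrix σ σ ℂ => coeff m (linSubst M G) := by
  classical
  induction G using MvPolynomial.induction_on generalizing m with
  | C c =>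
    simp only [linSubst_C]
    exact continuous_const
  | add p q hp hq =>
    simp only [map_add, coeff_add]
    exact (hp m).add (hq m)
  | mul_X p n hp =>
    have h : ∀ M : Matrix σ σ ℂ, coeff m (linSubst M (p * X n)) =
        ∑ x ∈ Finset.HasAntidiagonal.antidiagonal m, coeff x.1 (linSubst M p) * ∑ k, M n k * coeff x.2 (X k : MvPolynomial σ ℂ) := fun M => by
      rw [map_mul, coeff_mul]
      refine Finset.sum_congr rfl fun x _ => ?_
      rw [linSubst_X_eq_linForm, coeff_linForm]
    simp_rw [h]
    refine continuous_finsetSum _ fun x _ => (hp x.1).mul (continuous_finsetSum _ fun k _ => ?_)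
    exact (continuous_id.matrix_elem n k).mul continuous_const

/-- **a linear functional of `linSubst M G` is continuous in `M`**: `ℓ (linSubst M G) = Σ_{|m| ≤ deg G} coeff_m (linSubst M G) · ℓ (z^m)` over the FIXED finite set of
exponents of degree `≤ deg G` (★ `totalDegree_linSubst_le`, ★ `support_subset_degLE`). [folklore] -/
theorem continuous_dual_linSubst (G : MvPolynomial σ ℂ) (ℓ : MvPolynomial σ ℂ →ₗ[ℂ] ℂ) : Continuous fun M : Matrix σ σ ℂ => ℓ (linSubst M G) := by
  classical
  have hexp : ∀ M : Matrix σ σ ℂ, ℓ (linSubst M G) = ∑ m ∈ degLE G.totalDegree, coeff m (linSubst M G) • ℓ (monomial m 1) := by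
    intro M
    have hsum : linSubst M G = ∑ m ∈ degLE G.totalDegree, monomial m (coeff m (linSubst M G)) := by
      conv_lhs => rw [(linSubst M G).as_sum]
      exact Finset.sum_subset (support_subset_degLE (totalDegree_linSubst_le M G)) fun m _ hm => by
        rw [notMem_support_iff.mp hm, monomial_zero]
    conv_lhs => rw [hsum]
    rw [map_sum]
    refine Finset.sum_congr rfl fun m _ => ?_
    rw [show monomial m (coeff m (linSubst M G)) = coeff m (linSubst M G) • (monomial m (1 : ℂ) : MvPolynomial σ ℂ) by rw [smul_monomial, smul_eq_mul, mul_one],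
      map_smul]
  simp_rw [hexp]
  exact continuous_finsetSum _ fun m _ => (continuous_coeff_linSubst G m).smul continuous_const

variable {K : Type*} [Group K] [TopologicalSpace K] [IsTopologicalGroup K] [CompactSpace K] {W : Type*} [AddCommGroup W] [Module ℂ W]

/-- **THE POLYNOMIAL INSTANCE OF THE REYNOLDS REDUCTION**: for a continuous homomorphism `j : K →* U(σ)` of a compact group and a linear `Λ : ℂ[z_σ] →ₗ W` invariant
under the substitutions `F ↦ linSubst (j k)⋆ F` (`= F ∘ (j k)⁻¹`, the Bargmann reading of `μ₀(j k)`, ★ `unitaryOpPi_binvPi`), every polynomial `F` has a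
substitution-INVARIANT `F₀` with `Λ F = Λ F₀` (average over `K` inside the finite-dimensional stable space of polynomials of degree `≤ deg F`).
[cite: BrockerTomDieck1985, II (1.7)] [cite: Folland1989, Prop. (4.39)] -/
theorem exists_linSubst_invariant_of_invariant_functional (j : K →* Matrix.unitaryGroup σ ℂ) (hj : Continuous j) (Λ : MvPolynomial σ ℂ →ₗ[ℂ] W)
    (hΛ : ∀ (k : K) (F : MvPolynomial σ ℂ), Λ (linSubst (star (j k : Matrix σ σ ℂ)) F) = Λ F) (F : MvPolynomial σ ℂ) :
    ∃ F₀ : MvPolynomial σ ℂ, (∀ k : K, linSubst (star (j k : Matrix σ σ ℂ)) F₀ = F₀) ∧ Λ F = Λ F₀ := by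
  classical
  -- the substitution action as a homomorphism into `Module.End`
  let ρ : K →* Module.End ℂ (MvPolynomial σ ℂ) :=
    { toFun := fun k => (linSubst (star (j k : Matrix σ σ ℂ))).toLinearMap
      map_one' := by
        refine LinearMap.ext fun G => ?_
        rw [AlgHom.toLinearMap_apply, map_one, OneMemClass.coe_one, star_one, linSubst_one_apply, Module.End.one_apply]
      map_mul' := fun k k' => by
        refine LinearMap.ext fun G => ?_
        rw [AlgHom.toLinearMap_apply, Module.End.mul_apply, AlgHom.toLinearMap_apply, AlgHom.toLinearMap_apply, map_mul, Submonoid.coe_mul, star_mul,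
          linSubst_linSubst] }
  have hρ : ∀ (k : K) (G : MvPolynomial σ ℂ), ρ k G = linSubst (star (j k : Matrix σ σ ℂ)) G := fun k G => rfl
  have hU : ∀ k : K, ∀ G ∈ restrictTotalDegree σ ℂ F.totalDegree, ρ k G ∈ restrictTotalDegree σ ℂ F.totalDegree := fun k G hG => by
    rw [mem_restrictTotalDegree] at hG ⊢
    rw [hρ]
    exact (totalDegree_linSubst_le _ G).trans hG
  have hcont : ∀ G ∈ restrictTotalDegree σ ℂ F.totalDegree, ∀ ℓ : MvPolynomial σ ℂ →ₗ[ℂ] ℂ, Continuous fun k : K => ℓ (ρ k G) := fun G _ ℓ => by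
    simp_rw [hρ]
    exact (continuous_dual_linSubst G ℓ).comp (continuous_star.comp (continuous_subtype_val.comp hj))
  have hΛ' : ∀ (k : K) (G : MvPolynomial σ ℂ), Λ (ρ k G) = Λ G := fun k G => by rw [hρ, hΛ]
  have hF : F ∈ restrictTotalDegree σ ℂ F.totalDegree := by
    rw [mem_restrictTotalDegree]
  obtain ⟨F₀, -, hF₀, hΛF⟩ := exists_invariant_of_invariant_functional ρ (restrictTotalDegree σ ℂ F.totalDegree) hU hcont Λ hΛ' F hF
  exact ⟨F₀, fun k => by rw [← hρ, hF₀ k], hΛF⟩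

end Polynomial

/-! ## §4 ★ (E-f)'s letter (RED) at the one-place objects, modulo the see-saw pivot -/

section OnePlace

variable {R S : Type*} [Fintype R] [DecidableEq R] [Fintype S] [DecidableEq S] (e : VacExponents) {W : Type*} [AddCommGroup W] [Module ℂ W]
  (SW : SchwartzMap (DPIdx (Fin 2) (Fin 2) R S → ℝ) ℂ →ₗ[ℂ] W)

/-- **THE PIVOT MAKES THE SECTION FUNCTIONAL INVARIANT UNDER THE UNTWISTED SUBSTITUTION**: if `SW (κOp R S e (1,k) v) = vacScalar e (1,k) • SW v` (the see-saw pivot,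
letter `hpiv` by value) then `SW (binvPi (linSubst (star ↑(dualPairι (1,k))) F)) = SW (binvPi F)` — the vacuum character cancels (★ `unitaryOpPi_binvPi`,
★ `κOp = vacScalar • unitaryOpPi ∘ dualPairι`, ★ `vacScalar_ne_zero`). [cite: Folland1989, Prop. (4.39)] [cite: Howe1989, §3] -/
theorem sw_binvPi_linSubst_eq_of_pivot
    (hpiv : ∀ (k : Matrix.unitaryGroup R ℂ × Matrix.unitaryGroup S ℂ) (v : SchwartzMap (DPIdx (Fin 2) (Fin 2) R S → ℝ) ℂ),
      SW (κOp R S e ((1, k) : DPK (Fin 2) (Fin 2) R S) v) = vacScalar e ((1, k) : DPK (Fin 2) (Fin 2) R S) • SW v)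
    (k : Matrix.unitaryGroup R ℂ × Matrix.unitaryGroup S ℂ) (F : MvPolynomial (DPIdx (Fin 2) (Fin 2) R S) ℂ) :
    SW (binvPi (linSubst (star ((dualPairι ((1, k) : DPK (Fin 2) (Fin 2) R S) : Matrix.unitaryGroup (DPIdx (Fin 2) (Fin 2) R S) ℂ) :
      Matrix (DPIdx (Fin 2) (Fin 2) R S) (DPIdx (Fin 2) (Fin 2) R S) ℂ)) F)) = SW (binvPi F) := by
  have hne := vacScalar_ne_zero e ((1, k) : DPK (Fin 2) (Fin 2) R S)
  have hκ : ∀ v : SchwartzMap (DPIdx (Fin 2) (Fin 2) R S → ℝ) ℂ, κOp R S e ((1, k) : DPK (Fin 2) (Fin 2) R S) v =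
      vacScalar e ((1, k) : DPK (Fin 2) (Fin 2) R S) • unitaryOpPi (dualPairι ((1, k) : DPK (Fin 2) (Fin 2) R S)) v := fun v => rfl
  have h := hpiv k (binvPi F)
  rw [hκ, unitaryOpPi_binvPi, map_smul] at h
  exact smul_right_injective W hne h

/-- **★ (E-f)'s LETTER (RED), MODULO THE PIVOT**: for ANY linear section functional `SW` on the one-place Schwartz space satisfying the see-saw pivot
`SW (κOp R S e (1,k) v) = vacScalar e (1,k) • SW v` (`k ∈ K_H = U(R) × U(S)`), every Fock polynomial `F` has a polynomial `F₀` INVARIANT under the untwisted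
substitutions `linSubst (star ↑(dualPairι (1,k)))` with THE SAME SECTION `SW (binvPi F) = SW (binvPi F₀)` — `hRED` of ★ `K2LiuLocalThetaCyclicUniform` at
`subst k := (linSubst (star ↑(dualPairι (1,k)))).toLinearMap`, `B := binvPiₗ`, `G := U(R) × U(S)` (§3 with `j := dualPairι ∘ inr`, `Λ := SW ∘ₗ binvPiₗ`).
[cite: Howe1989, §3] [cite: KudlaRallis1994, §3] [cite: BrockerTomDieck1985, II (1.7)] -/
theorem hRED_of_pivot
    (hpiv : ∀ (k : Matrix.unitaryGroup R ℂ × Matrix.unitaryGroup S ℂ) (v : SchwartzMap (DPIdx (Fin 2) (Fin 2) R S → ℝ) ℂ),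
      SW (κOp R S e ((1, k) : DPK (Fin 2) (Fin 2) R S) v) = vacScalar e ((1, k) : DPK (Fin 2) (Fin 2) R S) • SW v)
    (F : MvPolynomial (DPIdx (Fin 2) (Fin 2) R S) ℂ) :
    ∃ F₀ : MvPolynomial (DPIdx (Fin 2) (Fin 2) R S) ℂ,
      (∀ k : Matrix.unitaryGroup R ℂ × Matrix.unitaryGroup S ℂ,
        linSubst (star ((dualPairι ((1, k) : DPK (Fin 2) (Fin 2) R S) : Matrix.unitaryGroup (DPIdx (Fin 2) (Fin 2) R S) ℂ) :
          Matrix (DPIdx (Fin 2) (Fin 2) R S) (DPIdx (Fin 2) (Fin 2) R S) ℂ)) F₀ = F₀) ∧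
      SW (binvPi F) = SW (binvPi F₀) := by
  haveI : CompactSpace (Matrix.unitaryGroup R ℂ) := compactSpace_matrixUnitaryGroup R
  haveI : CompactSpace (Matrix.unitaryGroup S ℂ) := compactSpace_matrixUnitaryGroup S
  let j : (Matrix.unitaryGroup R ℂ × Matrix.unitaryGroup S ℂ) →* Matrix.unitaryGroup (DPIdx (Fin 2) (Fin 2) R S) ℂ :=
    (dualPairι (P := Fin 2) (Q := Fin 2) (R := R) (S := S)).comp (MonoidHom.inr _ _)
  have hj_apply : ∀ k : Matrix.unitaryGroup R ℂ × Matrix.unitaryGroup S ℂ, j k = dualPairι ((1, k) : DPK (Fin 2) (Fin 2) R S) := fun k => rfl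
  have hj : Continuous j := continuous_dualPairι.comp (continuous_const.prodMk continuous_id)
  have hΛ : ∀ (k : Matrix.unitaryGroup R ℂ × Matrix.unitaryGroup S ℂ) (G : MvPolynomial (DPIdx (Fin 2) (Fin 2) R S) ℂ),
      (SW ∘ₗ binvPiₗ) (linSubst (star (j k : Matrix (DPIdx (Fin 2) (Fin 2) R S) (DPIdx (Fin 2) (Fin 2) R S) ℂ)) G) = (SW ∘ₗ binvPiₗ) G := fun k G => by
    rw [LinearMap.comp_apply, LinearMap.comp_apply, binvPiₗ_apply, binvPiₗ_apply, hj_apply]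
    exact sw_binvPi_linSubst_eq_of_pivot e SW hpiv k G
  obtain ⟨F₀, hF₀, hΛF⟩ := exists_linSubst_invariant_of_invariant_functional j hj (SW ∘ₗ binvPiₗ) hΛ F
  refine ⟨F₀, fun k => ?_, ?_⟩
  · rw [← hj_apply]
    exact hF₀ k
  · simpa only [LinearMap.comp_apply, binvPiₗ_apply] using hΛF

end OnePlace

end Summit.HodgeConjecture.HodgeConjecture.Cruxes.HLiu418.K2LiuLocalThetaReduction

end
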